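import Summits.ABC.IUTFork.Conditional.AbcOfSGenuineKTameRobustTriple
import Summits.ABC.IUTFork.Conditional.AbcOfSGenuineKChosenDepth
import Summits.ABC.IUTFork.Conditional.HexDepthArithmeticSharp
import Summits.ABC.IUTFork.Cor312SzpiroBadVsDepthExact
import Summits.ABC.ABC.Theorems.IUTThetaPilotThetaPartIIStubThetaData
import Literature.IUT.LogVolume.Corollary22RatPointDictionary
import Literature.IUT.LogVolume.Corollary22PartIIUpTo
import Literature.IUT.LogVolume.DepthConstantsTameBudget
import Mathlib.Analysis.Real.Pi.Bounds
import HarnessLib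

/-!
# R-W task «C:HSHW-REF» (tier 2/3), kit part 1: WINDOW MEMBERSHIP and the SZPIRO-BAD GUARD at a rational point of the `λ`-line —
# the two point-level antecedents of the binder `hSHwBad`, each from one inequality per bad prime / one inequality of natural numbers

PROOF-ONLY file (no `def`, no new `Prop`, no instance, no notation) of the abc-iut cell (seat abc-iut-W-ref-3, gen 0; R-W row «C:HSHW-REF
tier-2/3 (p = 167 [ED], p = 1061, p = 463)», abc-iut-w6-d102's second, files disjoint by prime). TAKES NO SIDE on [IUTchIII] Cor. 3.12 or on
any author. Everything here is COMPOSITION BY NAME of landed theorems; the per-prime files `AbcOfSHwindowFreyRefutation<p>.lean` instantiate it.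

The binder `hSHwBad` of the branch-C cut certificate of record `Conditional.abc_of_SH_v10K_window_szpiroBadAll` (abc-iut-s2-p2 p453137; parent
cuts abc-iut-c312-d1 p450130 / p449402) demands the hull-level clause S_H = `Cor312Vol.PilotKummerCompatHull` (CHOSEN realising ideles, PINNED
reading) at every genuine Θ-volume datum `T` over an ADMISSIBLE (`P ∈ U_P`, `l ≥ 5` prime, `AdmitsCore`, (P2), (P5), (P6)) and SZPIRO-BAD
`(P, l)` that is OFF the degree-form depth locus. A kernel refutation at a rational point `P = ratPoint λ` therefore needs, at ONE `(λ, l)`: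
(W) every datum over `(λ, l)` is off the depth locus; (G) the Szpiro-bad guard; (S) `¬ S_H` at every datum (for every choice of the free
context binders); (N) a datum exists — `ThetaPartII.stub_thetaData` (abc-iut-c312-8 / L5-t7) from admissibility, with (P6) = `Cor22.CondP6`
kept as a NAMED HYPOTHESIS (an existing definition; the image-of-Galois input is not decided in the tree at explicit points).

This part:
* §1 `FreyRef.not_deep_ratPoint` — (W) from ONE inequality per odd pole prime `p` of `j(λ)`:
  `((l⋆)²−1)·h_p ≤ 2l·((l⋆+1)(4 + 2·log_p l) + 1)` (`h_p = −ord_p j(λ)`, `l⋆ = (l−1)/2`), via abc-iut-w4-d078's exact window criterion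
  `GenuineK.not_deep_of_topLabel_le` (N₀ := l) and the tower identities `ord_{x₀}(j_E) = e(x₀|u)·ord_u j(λ)`, `e_{x₀} = e_u·e(x₀|u)`;
  arithmetic forms `FreyRef.topLabel_test_of_nat` (log term dropped) / `…_of_nat_logb` (certified `log_p l ≥ r/s` from `p^r ≤ l^s`);
  v2 (append-only): monotone forms `FreyRef.topLabel_test_of_le` / `…_of_le_logb` (a height `H ≤ B`, one bound `B` per point).
* §2 `FreyRef.szpiroBad_ratPoint_of_certificate` — (G) from abc-iut-c312-d1's EXACT dictionary (`Cor22.logQAvoid_ratPoint_eq_sum`,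
  `Cor22.logCondAvoid_ratPoint_eq_sum`: `j(λ) = N/∏_{p∈I} p^{e_p}`), `d_mod = 1`, `log-diff = 0`, `π < 3.15 = 63/20` (Mathlib `Real.pi_lt_d2`) and
  ONE inequality of natural numbers `(∏_J p)^A · 63^B < (∏_J p^{e_p})^n · 20^B` with `6(l+1)(l−1)·n ≤ A·(l+4)(l−3)`, `6l(l+5)·n ≤ B·(l+4)(l−3)`
  (`J` = the primes of `I` away from `{2, l}`).
Parts 2/3: `AbcOfSHwindowFreyRefutationDepth.lean` ((S) by explicit depth at a tame pole prime), `AbcOfSHwindowFreyRefutationApex.lean` (the apex).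

HONEST SCOPE (binding, abc-iut-w5-d107's framing adopted): SHARP reading; the per-label licence is a STRONGER-THAN-PRINT sufficient form of
(xi-f); nothing here bears on the printed GLOBAL inequality, the number-level Corollary (`Cor22.Cor312AtDatum`, the binder `hNumBad`), or any
author's intended hull; the θ-cut record (p460293) is untouched; (P6) at explicit points is ASSUMED, never proved here; «refuted as typed» ≠
«refuted in print»; typed ≠ proved; instantiated ≠ endorsed; no abc claim. [cite: Mochizuki2012, IUTchIII Cor. 3.12 p. 173–174, Step (xi-f) p. 184;
IUTchIV Prop. 1.2 p. 10, Thm. 1.10 p. 22–23, Cor. 2.2 (ii) proof (P2)(P5)(P6)(P7) p. 45–46] [cite: MochizukiGenEll2010, Def. 3.3 p. 12]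
[cite: DupuyHilado2025, §3.3, §3.4] [claim: Mochizuki2012, status: disputed] for every IUT sentence quoted.
-/

noncomputable section

open Set Function NumberField IsDedekindDomain

namespace Summit.ABC.IUTFork.Conditional

open Thm311 Thm311.Real Cor312 Cor312Vol Cor312Prov Literature.IUT.LogThetaLattice Literature.IUT.LogVolume
  Literature.IUT.HodgeTheaters Literature.IUT.LogVolume.ThetaData Literature.IUT.LogVolume.Cor22
open Literature.NumberTheory.NumberFields Literature.NumberTheory.GaloisRepresentations.Ultrametric
open Literature.NumberTheory.DiophantineGeometry Literature.NumberTheory.DiophantineGeometry.GenEll Summit.ABC.ABC.Theorems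

namespace FreyRef

/-! ## §1. (W) The window: no datum over a rational point is on the degree-form depth locus -/

/-- **Window membership at a rational point from one inequality per odd pole prime.** Let `T` be a genuine Θ-volume datum over
`(ratPoint λ, l)`. If at every place `u` of `ℚ` over an odd prime `p` with `ord_u j(λ) < 0` the TOP-LABEL test
`((l⋆)²−1)·(−ord_u j(λ)) ≤ 2l·((l⋆+1)(4 + 2·log_p l) + 1)` holds (`l⋆ = (l−1)/2`), then the depth antecedent of `hSHwBad` holds VERBATIM at
`T`: no packet `(p > 2, i, x₀)` has `p^{((i+2)(4+2·log_p[K:ℚ]))+1}·‖t_{q,x₀}‖^{(i+1)²−1} < 1` (abc-iut-w4-d078 `GenuineK.not_deep_of_topLabel_le` with the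
tower identities `ord_{x₀}(j_E) = e(x₀|u)·ord_u j(λ)`, `e_{x₀} = e_u·e(x₀|u)`, `e_u ≥ 1`). [cite: Mochizuki2012, IUTchIV Thm. 1.10 p. 22–23]
[cite: DupuyHilado2025, §3.4] [claim: Mochizuki2012, status: disputed] -/
theorem not_deep_ratPoint {q : ℚ} {l : ℕ} (T : Cor22.ThetaVolumeDatumAt (ratPoint q) l)
    (hH : ∀ u : HeightOneSpectrum (𝓞 ℚ), 2 < Rat.HeightOneSpectrum.natGenerator u → ord ℚ u (Cor22.jInv q) < 0 →
      ((((l - 1) / 2 : ℕ) : ℝ) ^ 2 - 1) * (-(ord ℚ u (Cor22.jInv q) : ℝ)) ≤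
        2 * (l : ℝ) * (((((l - 1) / 2 : ℕ) : ℝ) + 1) *
          (4 + 2 * Real.logb (Rat.HeightOneSpectrum.natGenerator u : ℕ) (l : ℕ)) + 1)) :
    letI := T.instFieldF; letI := T.instNumberFieldF; letI := T.instAlgebraF; letI := T.instFieldK
    letI := T.instNumberFieldK; letI := T.instAlgebraK; letI := T.instFieldFbar; letI := T.instAlgebraFbar
    letI := T.instAlgebraKFbar; letI := T.instIsElliptic
    ¬ (∃ (pp : Nat.Primes) (_ : 2 < (pp : ℕ)) (i : Fin (thetaIndex (pilotDataOfK T.D T.K)).lstar)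
        (x₀ : (thetaIndex (pilotDataOfK T.D T.K)).Fibre (.inr pp)),
      haveI : Fact (pp : ℕ).Prime := ⟨pp.2⟩
      ((pp : ℕ) : ℝ) ^ ((((i : ℕ) : ℝ) + 2) * (4 + 2 * Real.logb (pp : ℕ) (Module.finrank ℚ T.K)) + 1) *
        ‖(exists_realising_qIdeles_pilotDataOfK T.D).choose pp x₀‖ ^ (((i : ℕ) + 1) ^ 2 - 1) < 1) := by
  letI := T.instFieldF; letI := T.instNumberFieldF; letI := T.instAlgebraF; letI := T.instFieldK
  letI := T.instNumberFieldK; letI := T.instAlgebraK; letI := T.instFieldFbar; letI := T.instAlgebraFbar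
  letI := T.instAlgebraKFbar; letI := T.instIsElliptic
  refine GenuineK.not_deep_of_topLabel_le T.D fun pp x₀ hp2 _ => ?_
  haveI : Fact (pp : ℕ).Prime := ⟨pp.2⟩
  set w := placeOf (pilotDataOfK T.D T.K) pp.1 x₀ with hw
  have hgen : Rat.HeightOneSpectrum.natGenerator (finBelow ℚ T.K w) = (pp : ℕ) :=
    natGenerator_finBelow_placeOf T.D pp x₀
  have hlstar : (pilotDataOfK T.D T.K).lstar = (l - 1) / 2 := by
    show ((pilotDataOfK T.D T.K).l - 1) / 2 = (l - 1) / 2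
    rw [pilotDataOfK_l]
  have hjF : T.E.j = ((Cor22.jInv q : ℚ) : T.F) := by rw [T.j_eq]; exact eq_ratCast _ _
  have hjK : algebraMap T.F T.K T.E.j = algebraMap ℚ T.K (Cor22.jInv q) := by rw [hjF, map_ratCast, eq_ratCast]
  have h1 : ord T.K w (algebraMap T.F T.K T.E.j) =
      ((finBelow ℚ T.K w).asIdeal.ramificationIdx' w.asIdeal : ℤ) * ord ℚ (finBelow ℚ T.K w) (Cor22.jInv q) := by
    rw [hjK, Cor22.ord_algebraMap_eq]
  have h2 : ramIdx T.K w = ramIdx ℚ (finBelow ℚ T.K w) * (finBelow ℚ T.K w).asIdeal.ramificationIdx' w.asIdeal :=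
    ramIdx_eq_ramIdx_finBelow_mul (F := ℚ) (K := T.K) w
  have hr1 : (1 : ℝ) ≤ (ramIdx ℚ (finBelow ℚ T.K w) : ℝ) := by
    exact_mod_cast Nat.one_le_iff_ne_zero.mpr (ramIdx_ne_zero ℚ _)
  have he0 : (0 : ℝ) ≤ ((finBelow ℚ T.K w).asIdeal.ramificationIdx' w.asIdeal : ℝ) := Nat.cast_nonneg _
  have hl5 : 5 ≤ l := T.D.five_le_l
  have hp1 : (1 : ℝ) < ((pp : ℕ) : ℝ) := by exact_mod_cast pp.2.one_lt
  have hW : (0 : ℝ) ≤ ((((l - 1) / 2 : ℕ) : ℝ) + 1) * (4 + 2 * Real.logb ((pp : ℕ) : ℝ) ((l : ℕ) : ℝ)) + 1 := by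
    have hlog : 0 ≤ Real.logb ((pp : ℕ) : ℝ) ((l : ℕ) : ℝ) :=
      Real.logb_nonneg hp1 (by exact_mod_cast (show 1 ≤ l by omega))
    positivity
  have hC : (0 : ℝ) ≤ (((l - 1) / 2 : ℕ) : ℝ) ^ 2 - 1 := by
    have : (2 : ℝ) ≤ (((l - 1) / 2 : ℕ) : ℝ) := by exact_mod_cast (show 2 ≤ (l - 1) / 2 by omega)
    nlinarith
  have hl0 : (0 : ℝ) ≤ (l : ℝ) := Nat.cast_nonneg _
  rw [h1, h2, hlstar]
  push_cast
  by_cases hneg : ord ℚ (finBelow ℚ T.K w) (Cor22.jInv q) < 0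
  · have hmain := hH (finBelow ℚ T.K w) (by rw [hgen]; exact hp2) hneg
    rw [hgen] at hmain
    -- `C·(−e'·o) = e'·(C·(−o)) ≤ e'·(2lW) ≤ (e_u·e')·(2lW)`
    have step1 : ((((l - 1) / 2 : ℕ) : ℝ) ^ 2 - 1) *
        -((((finBelow ℚ T.K w).asIdeal.ramificationIdx' w.asIdeal : ℝ)) * (ord ℚ (finBelow ℚ T.K w) (Cor22.jInv q) : ℝ)) ≤
        (((finBelow ℚ T.K w).asIdeal.ramificationIdx' w.asIdeal : ℝ)) *
          (2 * (l : ℝ) * (((((l - 1) / 2 : ℕ) : ℝ) + 1) * (4 + 2 * Real.logb ((pp : ℕ) : ℝ) ((l : ℕ) : ℝ)) + 1)) := by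
      have := mul_le_mul_of_nonneg_left hmain he0
      nlinarith
    have step2 : (((finBelow ℚ T.K w).asIdeal.ramificationIdx' w.asIdeal : ℝ)) *
          (2 * (l : ℝ) * (((((l - 1) / 2 : ℕ) : ℝ) + 1) * (4 + 2 * Real.logb ((pp : ℕ) : ℝ) ((l : ℕ) : ℝ)) + 1)) ≤
        2 * (l : ℝ) * ((ramIdx ℚ (finBelow ℚ T.K w) : ℝ) * ((finBelow ℚ T.K w).asIdeal.ramificationIdx' w.asIdeal : ℝ)) *
          (((((l - 1) / 2 : ℕ) : ℝ) + 1) * (4 + 2 * Real.logb ((pp : ℕ) : ℝ) ((l : ℕ) : ℝ)) + 1) := by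
      have h0 : 0 ≤ (((finBelow ℚ T.K w).asIdeal.ramificationIdx' w.asIdeal : ℝ)) *
          (2 * (l : ℝ) * (((((l - 1) / 2 : ℕ) : ℝ) + 1) * (4 + 2 * Real.logb ((pp : ℕ) : ℝ) ((l : ℕ) : ℝ)) + 1)) := by
        positivity
      nlinarith
    exact step1.trans step2
  · have ho : (0 : ℝ) ≤ (ord ℚ (finBelow ℚ T.K w) (Cor22.jInv q) : ℝ) := by exact_mod_cast not_lt.mp hneg
    have hL : ((((l - 1) / 2 : ℕ) : ℝ) ^ 2 - 1) *
        -((((finBelow ℚ T.K w).asIdeal.ramificationIdx' w.asIdeal : ℝ)) * (ord ℚ (finBelow ℚ T.K w) (Cor22.jInv q) : ℝ)) ≤ 0 := by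
      have : 0 ≤ ((((l - 1) / 2 : ℕ) : ℝ) ^ 2 - 1) *
          ((((finBelow ℚ T.K w).asIdeal.ramificationIdx' w.asIdeal : ℝ)) * (ord ℚ (finBelow ℚ T.K w) (Cor22.jInv q) : ℝ)) :=
        mul_nonneg hC (mul_nonneg he0 ho)
      linarith
    have hR : 0 ≤ 2 * (l : ℝ) * ((ramIdx ℚ (finBelow ℚ T.K w) : ℝ) * ((finBelow ℚ T.K w).asIdeal.ramificationIdx' w.asIdeal : ℝ)) *
        (((((l - 1) / 2 : ℕ) : ℝ) + 1) * (4 + 2 * Real.logb ((pp : ℕ) : ℝ) ((l : ℕ) : ℝ)) + 1) := by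
      positivity
    exact hL.trans hR

/-- **Arithmetic form of the §1 test at a pole of height `h`**: `((l⋆)²−1)·h ≤ 2l·(4(l⋆+1) + 1)` (the `log_p l ≥ 0` term dropped) suffices.
[folklore] -/
theorem topLabel_test_of_nat {l h p : ℕ} (hp : 1 < p) (hl : 3 ≤ l)
    (hn : (((l - 1) / 2) ^ 2 - 1) * h ≤ 2 * l * (4 * ((l - 1) / 2 + 1) + 1)) :
    ((((l - 1) / 2 : ℕ) : ℝ) ^ 2 - 1) * (h : ℝ) ≤
      2 * (l : ℝ) * (((((l - 1) / 2 : ℕ) : ℝ) + 1) * (4 + 2 * Real.logb (p : ℝ) (l : ℝ)) + 1) := by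
  have hlog : 0 ≤ Real.logb (p : ℝ) (l : ℝ) :=
    Real.logb_nonneg (by exact_mod_cast hp) (by exact_mod_cast (show 1 ≤ l by omega))
  have h1 : 1 ≤ ((l - 1) / 2) ^ 2 := Nat.one_le_pow _ _ (by omega)
  have hnR : (((((l - 1) / 2 : ℕ) : ℝ)) ^ 2 - 1) * (h : ℝ) ≤ 2 * (l : ℝ) * (4 * ((((l - 1) / 2 : ℕ) : ℝ) + 1) + 1) := by
    have := hn
    have hc : ((((((l - 1) / 2) ^ 2 - 1) * h : ℕ)) : ℝ) ≤ ((2 * l * (4 * ((l - 1) / 2 + 1) + 1) : ℕ) : ℝ) := by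
      exact_mod_cast this
    push_cast [Nat.cast_sub h1] at hc
    exact hc
  have hm : (0 : ℝ) ≤ 2 * (l : ℝ) * (((((l - 1) / 2 : ℕ) : ℝ) + 1) * (2 * Real.logb (p : ℝ) (l : ℝ))) := by positivity
  nlinarith

/-- **Arithmetic form with a certified `log_p l ≥ r/s`** (`p^r ≤ l^s`, `s > 0`): `s·((l⋆)²−1)·h ≤ 2l·(s·(4(l⋆+1) + 1) + 2r(l⋆+1))` suffices.
[folklore] -/
theorem topLabel_test_of_nat_logb {l h p r s : ℕ} (hp : 1 < p) (hl : 3 ≤ l) (hs : 0 < s) (hpow : p ^ r ≤ l ^ s)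
    (hn : s * ((((l - 1) / 2) ^ 2 - 1) * h) ≤ 2 * l * (s * (4 * ((l - 1) / 2 + 1) + 1) + 2 * r * ((l - 1) / 2 + 1))) :
    ((((l - 1) / 2 : ℕ) : ℝ) ^ 2 - 1) * (h : ℝ) ≤
      2 * (l : ℝ) * (((((l - 1) / 2 : ℕ) : ℝ) + 1) * (4 + 2 * Real.logb (p : ℝ) (l : ℝ)) + 1) := by
  have hp0 : (0 : ℝ) < p := by exact_mod_cast (show 0 < p by omega)
  have hp1 : (1 : ℝ) < p := by exact_mod_cast hp
  have hl0 : (0 : ℝ) < l := by exact_mod_cast (show 0 < l by omega)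
  have hsR : (0 : ℝ) < s := by exact_mod_cast hs
  -- `r/s ≤ log_p l`
  have hlogb : (r : ℝ) / s ≤ Real.logb (p : ℝ) (l : ℝ) := by
    rw [div_le_iff₀ hsR, Real.logb, div_mul_eq_mul_div, le_div_iff₀ (Real.log_pos hp1)]
    have h := Real.log_le_log (by positivity) (show ((p : ℝ) ^ r) ≤ (l : ℝ) ^ s by exact_mod_cast hpow)
    rw [Real.log_pow, Real.log_pow] at h
    linarith
  have h1 : 1 ≤ ((l - 1) / 2) ^ 2 := Nat.one_le_pow _ _ (by omega)
  have hnR : (s : ℝ) * ((((((l - 1) / 2 : ℕ) : ℝ)) ^ 2 - 1) * (h : ℝ)) ≤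
      2 * (l : ℝ) * ((s : ℝ) * (4 * ((((l - 1) / 2 : ℕ) : ℝ) + 1) + 1) + 2 * r * ((((l - 1) / 2 : ℕ) : ℝ) + 1)) := by
    have hc : (((s * ((((l - 1) / 2) ^ 2 - 1) * h) : ℕ)) : ℝ) ≤
        ((2 * l * (s * (4 * ((l - 1) / 2 + 1) + 1) + 2 * r * ((l - 1) / 2 + 1)) : ℕ) : ℝ) := by
      exact_mod_cast hn
    push_cast [Nat.cast_sub h1] at hc
    exact hc
  -- divide by `s` and use `r/s ≤ log_p l`
  have hj0 : (0 : ℝ) ≤ (((l - 1) / 2 : ℕ) : ℝ) + 1 := by positivity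
  have key : (s : ℝ) * (((((l - 1) / 2 : ℕ) : ℝ) ^ 2 - 1) * (h : ℝ)) ≤
      (s : ℝ) * (2 * (l : ℝ) * (((((l - 1) / 2 : ℕ) : ℝ) + 1) * (4 + 2 * Real.logb (p : ℝ) (l : ℝ)) + 1)) := by
    have h2 : 2 * (r : ℝ) * ((((l - 1) / 2 : ℕ) : ℝ) + 1) ≤
        (s : ℝ) * (2 * Real.logb (p : ℝ) (l : ℝ) * ((((l - 1) / 2 : ℕ) : ℝ) + 1)) := by
      have h3 : (r : ℝ) ≤ s * Real.logb (p : ℝ) (l : ℝ) := by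
        have := mul_le_mul_of_nonneg_left hlogb hsR.le
        rwa [mul_div_cancel₀ _ hsR.ne'] at this
      nlinarith [mul_le_mul_of_nonneg_right h3 hj0]
    nlinarith
  exact le_of_mul_le_mul_left key hsR

/-- **Monotone form of the §1 test** (v2, append-only): a local height `H ≤ B` with `((l⋆)²−1)·B ≤ 2l·(4(l⋆+1) + 1)` passes — one bound `B` for all
the odd bad primes of a point. [folklore] -/
theorem topLabel_test_of_le {l p B : ℕ} {H : ℝ} (hp : 1 < p) (hl : 3 ≤ l) (hH : H ≤ (B : ℝ))
    (hn : (((l - 1) / 2) ^ 2 - 1) * B ≤ 2 * l * (4 * ((l - 1) / 2 + 1) + 1)) :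
    ((((l - 1) / 2 : ℕ) : ℝ) ^ 2 - 1) * H ≤
      2 * (l : ℝ) * (((((l - 1) / 2 : ℕ) : ℝ) + 1) * (4 + 2 * Real.logb (p : ℝ) (l : ℝ)) + 1) := by
  have hC : (0 : ℝ) ≤ (((l - 1) / 2 : ℕ) : ℝ) ^ 2 - 1 := by
    have : (1 : ℝ) ≤ (((l - 1) / 2 : ℕ) : ℝ) := by exact_mod_cast (show 1 ≤ (l - 1) / 2 by omega)
    nlinarith
  exact (mul_le_mul_of_nonneg_left hH hC).trans (topLabel_test_of_nat hp hl hn)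

/-- **Monotone form with a certified `log_p l ≥ r/s`** (v2, append-only): `H ≤ B`, `p^r ≤ l^s`, `s·((l⋆)²−1)·B ≤ 2l·(s·(4(l⋆+1) + 1) + 2r(l⋆+1))`.
[folklore] -/
theorem topLabel_test_of_le_logb {l p B r s : ℕ} {H : ℝ} (hp : 1 < p) (hl : 3 ≤ l) (hH : H ≤ (B : ℝ)) (hs : 0 < s) (hpow : p ^ r ≤ l ^ s)
    (hn : s * ((((l - 1) / 2) ^ 2 - 1) * B) ≤ 2 * l * (s * (4 * ((l - 1) / 2 + 1) + 1) + 2 * r * ((l - 1) / 2 + 1))) :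
    ((((l - 1) / 2 : ℕ) : ℝ) ^ 2 - 1) * H ≤
      2 * (l : ℝ) * (((((l - 1) / 2 : ℕ) : ℝ) + 1) * (4 + 2 * Real.logb (p : ℝ) (l : ℝ)) + 1) := by
  have hC : (0 : ℝ) ≤ (((l - 1) / 2 : ℕ) : ℝ) ^ 2 - 1 := by
    have : (1 : ℝ) ≤ (((l - 1) / 2 : ℕ) : ℝ) := by exact_mod_cast (show 1 ≤ (l - 1) / 2 by omega)
    nlinarith
  exact (mul_le_mul_of_nonneg_left hH hC).trans (topLabel_test_of_nat_logb hp hl hs hpow hn)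

/-! ## §2. (G) The Szpiro-bad guard at a rational point from ONE inequality of natural numbers -/

/-- **The Szpiro-bad guard of `hSHwBad` at `(ratPoint λ, l)` by an integer certificate.** With abc-iut-c312-d1's dictionary data
(`j(λ) = N/∏_{p∈I} p^{e_p}`, `e_p ≥ 1`, `p ∤ N` on the primes of `I` away from `{2, l}`), `J` the primes of `I` away from `{2, l}`, and naturals
`A, B, n ≥ 1` with `6(l+1)(l−1)·n ≤ A·(l+4)(l−3)`, `6l(l+5)·n ≤ B·(l+4)(l−3)`: the inequality `(∏_J p)^A·63^B < (∏_J p^{e_p})^n·20^B` gives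
the guard `(l+5)/4 < d_mod ∨ 6l(l+5−4d_mod)/((l+4)(l−3))·(log-diff + (1−1/l)·log 𝔣^{∤2l}) + 6l(l+5)/((l+4)(l−3))·log π < log q^{∤2l}`
(second disjunct; `d_mod = 1`, `log-diff = 0`, `log q^{∤2l} = Σ_J e_p log p`, `log 𝔣^{∤2l} = Σ_J log p`, `π < 63/20`).
[cite: Mochizuki2012, IUTchIV Thm. 1.10 p. 22–23; IUTchIII Cor. 3.12 p. 173–174] [claim: Mochizuki2012, status: disputed] -/
theorem szpiroBad_ratPoint_of_certificate {q : ℚ} {N D : ℕ} {I : Finset ℕ} {e : ℕ → ℕ}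
    (hI : ∀ p ∈ I, p.Prime) (he : ∀ p ∈ I, e p ≠ 0) (hD : D = ∏ p ∈ I, p ^ e p)
    (hj : Cor22.jInv q = (N : ℚ) / (D : ℚ)) (hN : N ≠ 0) {l : ℕ} (h5 : 5 ≤ l)
    (hcop : ∀ p ∈ I, (∀ s ∈ ({2, l} : Finset ℕ), ¬ p ∣ s) → ¬ p ∣ N)
    (J : Finset ℕ) (hJ : J = I.filter (fun p => ¬ p ∣ 2 ∧ ¬ p ∣ l))
    (A B n : ℕ) (hn : 0 < n)
    (hA : 6 * (l + 1) * (l - 1) * n ≤ A * ((l + 4) * (l - 3)))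
    (hB : 6 * l * (l + 5) * n ≤ B * ((l + 4) * (l - 3)))
    (hcert : (∏ p ∈ J, p) ^ A * 63 ^ B < (∏ p ∈ J, p ^ e p) ^ n * 20 ^ B) :
    ((l : ℝ) + 5) / 4 < (Cor22.dmod (ratPoint q) : ℝ) ∨
      6 * l * (((l : ℝ) + 5) - 4 * Cor22.dmod (ratPoint q)) / (((l : ℝ) + 4) * ((l : ℝ) - 3))
          * ((ratPoint q).logDiff + (1 - 1 / (l : ℝ)) * Cor22.logCondAvoid (ratPoint q) {2, l})
        + 6 * l * ((l : ℝ) + 5) / (((l : ℝ) + 4) * ((l : ℝ) - 3)) * Real.log Real.pi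
        < Cor22.logQAvoid (ratPoint q) {2, l} := by
  classical
  right
  have hdmod : Cor22.dmod (ratPoint q) = 1 := Cor22.dmod_eq_one_of_degree_le_one (le_of_eq (degree_ratPoint q))
  have hfilter : ∀ S : Finset ℕ, S = {2, l} → I.filter (fun p => ∀ s ∈ S, ¬ p ∣ s) = J := by
    rintro S rfl
    rw [hJ]
    ext p
    simp only [Finset.mem_filter, Finset.mem_insert, Finset.mem_singleton, forall_eq_or_imp, forall_eq]
  rw [hdmod, logDiff_ratPoint q, Cor22.logQAvoid_ratPoint_eq_sum hI he hD hj hN {2, l} hcop,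
    Cor22.logCondAvoid_ratPoint_eq_sum hI he hD hj hN {2, l} hcop, hfilter _ rfl]
  -- the sums as logarithms of natural numbers
  have hJI : ∀ p ∈ J, p ∈ I := fun p hp => by
    rw [hJ] at hp
    exact (Finset.mem_filter.1 hp).1
  have hJpos : ∀ p ∈ J, 0 < p := fun p hp => (hI p (hJI p hp)).pos
  have hX : ∑ p ∈ J, Real.log (p : ℝ) = Real.log (((∏ p ∈ J, p : ℕ)) : ℝ) := by
    rw [Nat.cast_prod, Real.log_prod]
    intro p hp
    exact_mod_cast (hJpos p hp).ne'
  have hY : ∑ p ∈ J, (e p : ℝ) * Real.log (p : ℝ) = Real.log (((∏ p ∈ J, p ^ e p : ℕ)) : ℝ) := by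
    rw [Nat.cast_prod, Real.log_prod]
    · exact Finset.sum_congr rfl fun p _ => by rw [Nat.cast_pow, Real.log_pow]
    · intro p hp
      exact_mod_cast (pow_pos (hJpos p hp) _).ne'
  set X : ℝ := ∑ p ∈ J, Real.log (p : ℝ) with hXdef
  set Y : ℝ := ∑ p ∈ J, (e p : ℝ) * Real.log (p : ℝ) with hYdef
  have hX0 : 0 ≤ X := Finset.sum_nonneg fun p hp =>
    Real.log_nonneg (by exact_mod_cast Nat.one_le_iff_ne_zero.mpr (hJpos p hp).ne')
  -- the certificate in logarithms: `A·X + B·log 63 < n·Y + B·log 20`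
  have hP0 : (0 : ℝ) < ((∏ p ∈ J, p : ℕ) : ℝ) := by exact_mod_cast Finset.prod_pos fun p hp => hJpos p hp
  have hQ0 : (0 : ℝ) < ((∏ p ∈ J, p ^ e p : ℕ) : ℝ) := by
    exact_mod_cast Finset.prod_pos fun p hp => pow_pos (hJpos p hp) _
  have hcertR : (A : ℝ) * X + B * Real.log 63 < n * Y + B * Real.log 20 := by
    have hL : (0 : ℝ) < (((∏ p ∈ J, p : ℕ)) : ℝ) ^ A * (63 : ℝ) ^ B := mul_pos (pow_pos hP0 _) (pow_pos (by norm_num) _)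
    have hcast : (((∏ p ∈ J, p : ℕ)) : ℝ) ^ A * (63 : ℝ) ^ B < (((∏ p ∈ J, p ^ e p : ℕ)) : ℝ) ^ n * (20 : ℝ) ^ B := by
      exact_mod_cast hcert
    have h := Real.log_lt_log hL hcast
    rw [Real.log_mul (pow_pos hP0 _).ne' (pow_pos (by norm_num) _).ne',
      Real.log_mul (pow_pos hQ0 _).ne' (pow_pos (by norm_num) _).ne',
      Real.log_pow, Real.log_pow, Real.log_pow, Real.log_pow, ← hX, ← hY] at h
    linarith
  -- `log π < log 63 − log 20`
  have hπ : Real.log Real.pi < Real.log 63 - Real.log 20 := by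
    rw [← Real.log_div (by norm_num) (by norm_num)]
    exact Real.log_lt_log Real.pi_pos (lt_of_lt_of_le Real.pi_lt_d2 (by norm_num))
  have hπ0 : 0 < Real.log Real.pi := Real.log_pos (by linarith [Real.pi_gt_three])
  -- the coefficients
  have hl3 : (3 : ℝ) < l := by exact_mod_cast (show 3 < l by omega)
  have hden : (0 : ℝ) < ((l : ℝ) + 4) * ((l : ℝ) - 3) := by nlinarith
  have hnR : (0 : ℝ) < n := by exact_mod_cast hn
  have hl0 : (0 : ℝ) < l := by linarith
  have hAR : 6 * ((l : ℝ) + 1) * ((l : ℝ) - 1) * n ≤ A * (((l : ℝ) + 4) * ((l : ℝ) - 3)) := by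
    have h := hA
    have hc : (((6 * (l + 1) * (l - 1) * n : ℕ)) : ℝ) ≤ ((A * ((l + 4) * (l - 3)) : ℕ) : ℝ) := by exact_mod_cast h
    push_cast [Nat.cast_sub (show 1 ≤ l by omega), Nat.cast_sub (show 3 ≤ l by omega)] at hc
    exact hc
  have hBR : 6 * (l : ℝ) * ((l : ℝ) + 5) * n ≤ B * (((l : ℝ) + 4) * ((l : ℝ) - 3)) := by
    have h := hB
    have hc : (((6 * l * (l + 5) * n : ℕ)) : ℝ) ≤ ((B * ((l + 4) * (l - 3)) : ℕ) : ℝ) := by exact_mod_cast h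
    push_cast [Nat.cast_sub (show 3 ≤ l by omega)] at hc
    exact hc
  -- rewrite the left-hand side with the two coefficients `c₁ = 6(l+1)(l−1)/((l+4)(l−3))`, `c₂ = 6l(l+5)/((l+4)(l−3))`
  have hc1 : 6 * (l : ℝ) * (((l : ℝ) + 5) - 4 * ((1 : ℕ) : ℝ)) / (((l : ℝ) + 4) * ((l : ℝ) - 3)) * (0 + (1 - 1 / (l : ℝ)) * X) =
      (6 * ((l : ℝ) + 1) * ((l : ℝ) - 1) / (((l : ℝ) + 4) * ((l : ℝ) - 3))) * X := by
    field_simp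
    ring
  rw [hc1]
  set c₁ : ℝ := 6 * ((l : ℝ) + 1) * ((l : ℝ) - 1) / (((l : ℝ) + 4) * ((l : ℝ) - 3)) with hc₁
  set c₂ : ℝ := 6 * (l : ℝ) * ((l : ℝ) + 5) / (((l : ℝ) + 4) * ((l : ℝ) - 3)) with hc₂
  have hc1A : c₁ ≤ (A : ℝ) / n := by
    rw [hc₁, div_le_div_iff₀ hden hnR]
    nlinarith
  have hc2B : c₂ ≤ (B : ℝ) / n := by
    rw [hc₂, div_le_div_iff₀ hden hnR]
    nlinarith
  have hc20 : 0 ≤ c₂ := by rw [hc₂]; positivity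
  have hB0 : (0 : ℝ) ≤ B := Nat.cast_nonneg _
  -- chain
  calc c₁ * X + c₂ * Real.log Real.pi
      ≤ (A : ℝ) / n * X + (B : ℝ) / n * Real.log Real.pi := by
        gcongr
    _ < (A : ℝ) / n * X + (B : ℝ) / n * (Real.log 63 - Real.log 20) + ((n : ℝ) * Y + B * Real.log 20 - (A * X + B * Real.log 63)) / n := by
        have h1 : (A : ℝ) / n * X + (B : ℝ) / n * Real.log Real.pi ≤ (A : ℝ) / n * X + (B : ℝ) / n * (Real.log 63 - Real.log 20) := by
          gcongr
        have h2 : 0 < ((n : ℝ) * Y + B * Real.log 20 - (A * X + B * Real.log 63)) / n := div_pos (by linarith) hnR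
        linarith
    _ = Y := by
        field_simp
        ring


end FreyRef

end Summit.ABC.IUTFork.Conditional

end
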